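import Summits.QuantumFields.BalabanUV.Beta.FP.ScalarMinimiserLetters

/-!
# `BalabanUV.Beta.FP.ScalarMinimiserLettersPt` — road «FP» (binder row D1), row **GAMMA-9 (I-gh)**, COMPANION of `FP/ScalarMinimiserLetters`:
# the scalar minimiser's letters IN THE ROAD's SPELLING (`d = 4`, `Pt`, blocking `N ≥ 1` = pv23's `n + 1`, `𝓘_gh(c,u) := kerH (N−1) a c u`) —
# VERBATIM the hypothesis shapes (I)∕(J) `hI`∕`hJ` and (J′) `hJ'` of `MixLoopPowerCountingMass.coarse_mix2_secondMoment_le`, constants N-FREE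

HONEST DEPENDENCY (page 1, mandatory): continuum YM on T⁴ ⇐ BetaPertH ∧ nine spine estimates (0/9 proved); BetaPertH ⇐ (D1) ∧ (D4) ∧
CAP+tail; G-an2-4 gates asym, D1 and NE2/3/4.  HONEST FRAMING (cell contract, verbatim): «discharging `BetaPertH` makes Bałaban's UV
stability UNCONDITIONAL — a real constructive-QFT result; it is NOT the continuum limit and NOT the Clay problem.»  THIS MODULE is [folklore]
lattice bookkeeping over `FP/ScalarMinimiserLetters.exists_kerH_letters` BY NAME (block geometry `B6QGQLower276`, `CoarseInverseScalar.dist_eq_supNorm`,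
the coarse exponential sum `B4Sect5Proof.latticeSum_le`); no `def`, no `def … : Prop`, nothing cited, 0 sorry; the object is pv23's SCALAR
whole-lattice minimiser (not Bałaban's printed vector `H_k`).  NOT (GH-a), NOT `hbook`, NOT D1, NOT BetaPertH, NOT continuum, NOT Clay.

ABSOLUTE RULE (cell charter, verbatim): «No internally-minted statement may enter as a cited fact. Every hypothesis is either kernel-proved in this
package or a verbatim quotation of a PUBLISHED theorem with page reference. The manuscript(s) under audit are NOT citable for their own disputed
steps — they are the thing under adjudication; programme-internal (2001/route/tribunal) claims are never citable.»

CONTENT (the «road spelling» item (d) of t4-ne7b-formalise-leaf-04-g22's reconnaissance N-ne7bleaf04g22-1, folded per the owner l.26226 (2)).  §1 block geometry, both sides: `‖p − q‖∞ ≤ (n+1)‖y − y′‖∞ + n` for `p ∈ B(y)`, `q ∈ B(y′)` (`dist_le_blk_dist`; the lower side is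
`B6QGQDecay237.dist_blk_ge`), the base corner `chart n v 0 = (n+1)•v`, and `e^{−δ‖blk b − v‖∞} ≤ e^{δ}·e^{−(δ∕(n+1))‖b − (n+1)•v‖∞}`.
§2 the passage BLOCK FORM ⟹ ROAD FORM for any rate∕constant (`letters_Pt_of_blk`, `coarseMoment_Pt_of_blk`), then
**`exists_kerH_letters_Pt`**: `∃ C_I ≥ 0` (ABSOLUTE: independent of `a` AND of `N`, by `ScalarMinimiserLetters.exists_kerH_letters_afree`)
`∀ a > 0, ∀ N ≥ 1, ∀ c u : Pt`, `|kerH (N−1) a c u| ≤ C_I·e^{−(δ∕N)·‖c − N•u‖∞}` and `∀ j, |kerH (N−1) a (c + e_j) u − kerH (N−1) a c u| ≤ (C_I∕N)·e^{−(δ∕N)·‖c − N•u‖∞}`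
with the rate `δ := B5Hk103ScalarZd.deltaH 4 1` (any `a` gives the same kernel; `a = 1` names the rate); `exists_kerH_letters_Pt_rate` = the same at
the `a`-dependent rate `deltaH 4 a` with the displayed constant `C₀(4)·K(4,a)·e^{δ_H(4,a)}`.
§3 **`exists_kerH_coarseMoment_Pt`**: `∃ C_J′ ≥ 0, ∀ a > 0, ∀ N ≥ 1, ∀ b′ V`, `Σ_{v∈V} (1 + (‖b′ − N•v‖∞∕N)²)·|kerH (N−1) a b′ v| ≤ C_J′`
(a square against an exponential at rate `∕N` costs no power of `N`; `C_J′ = 2·C·16e^{δ∕2}∕δ²·K₄(δ∕2)`).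
The normalisation of `Q′` in the road's units (block AVERAGE vs block SUM: a factor `N^{∓d}` on `𝓘`) is row RHOA-6e's ∕ (GH-a)'s bookkeeping, not fixed here.
Provenance: unit `b2b-balaban-t4-ne7b-formalise-leaf-10` (gen 26, cross-cell idle-seat duty NE7b → FP), 2026-08-21; «not in print; our bookkeeping».
-/

noncomputable section

namespace Summit.QuantumFields.BalabanUV.Beta.FP.ScalarMinimiserLettersPt

open Finset Real
open scoped BigOperators
open Literature.MathematicalPhysics.QuantumFieldTheory.Balaban1983to89
open B6QGQLower276 (X e B blk chart side loc mem_B chart_mem_B side_mul_blk_add_loc loc_nonneg loc_le)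
open B6QGQDecay237 (cInv deltaInv cInv_pos deltaInv_pos)
open B5Hk103ScalarZd (kerH cH deltaH cH_pos deltaH_pos)
open ScalarMinimiserLetters (exists_kerH_letters exists_kerH_letters_afree)

variable {d : ℕ}

/-! ## §1 Block geometry, both sides -/

/-- [folklore] fine distance versus block distance, upper side: `‖p − q‖∞ ≤ (n+1)·‖y − y′‖∞ + n` for `p ∈ B(y)`, `q ∈ B(y′)`
(the lower side is `B6QGQDecay237.dist_blk_ge`). -/
theorem dist_le_blk_dist {n : ℕ} {y y' p q : X d} (hp : p ∈ B n y) (hq : q ∈ B n y') :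
    dist p q ≤ ((n : ℝ) + 1) * dist y y' + n := by
  refine (dist_pi_le_iff (by positivity)).2 fun μ => ?_
  have h1 := side_mul_blk_add_loc n p μ
  have h2 := side_mul_blk_add_loc n q μ
  rw [mem_B.1 hp] at h1
  rw [mem_B.1 hq] at h2
  have l1 := loc_nonneg n p μ; have l2 := loc_le n p μ
  have l3 := loc_nonneg n q μ; have l4 := loc_le n q μ
  have hd : dist (y μ) (y' μ) ≤ dist y y' := dist_le_pi_dist y y' μ
  rw [Int.dist_eq] at hd ⊢
  have hs : side n = (n : ℤ) + 1 := rfl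
  rw [hs] at h1 h2
  have e1 : ((p μ : ℤ) : ℝ) - q μ = ((n : ℝ) + 1) * ((y μ : ℝ) - y' μ) + (((loc n p μ : ℤ) : ℝ) - loc n q μ) := by
    have h1' : (((n : ℤ) + 1) * y μ + loc n p μ : ℤ) = p μ := h1
    have h2' : (((n : ℤ) + 1) * y' μ + loc n q μ : ℤ) = q μ := h2
    have c1 := congrArg (fun z : ℤ => (z : ℝ)) h1'
    have c2 := congrArg (fun z : ℤ => (z : ℝ)) h2'
    push_cast at c1 c2 ⊢
    linarith
  have hloc : |(((loc n p μ : ℤ) : ℝ) - loc n q μ)| ≤ n := by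
    rw [abs_le]
    constructor
    · have : ((loc n q μ : ℤ) : ℝ) ≤ n := by exact_mod_cast l4
      have : (0 : ℝ) ≤ ((loc n p μ : ℤ) : ℝ) := by exact_mod_cast l1
      linarith
    · have : ((loc n p μ : ℤ) : ℝ) ≤ n := by exact_mod_cast l2
      have : (0 : ℝ) ≤ ((loc n q μ : ℤ) : ℝ) := by exact_mod_cast l3
      linarith
  have hn0 : (0 : ℝ) ≤ (n : ℝ) + 1 := by positivity
  rw [e1]
  calc |((n : ℝ) + 1) * ((y μ : ℝ) - y' μ) + (((loc n p μ : ℤ) : ℝ) - loc n q μ)|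
      ≤ |((n : ℝ) + 1) * ((y μ : ℝ) - y' μ)| + |(((loc n p μ : ℤ) : ℝ) - loc n q μ)| := abs_add_le _ _
    _ ≤ ((n : ℝ) + 1) * dist y y' + n := by
        rw [abs_mul, abs_of_nonneg hn0]
        have := mul_le_mul_of_nonneg_left hd hn0
        linarith

/-- [folklore] the base corner of block `v` is the site `(n+1)•v`: `chart n v 0 = ((n:ℤ)+1) • v`. -/
theorem chart_zero_eq_smul (n : ℕ) (v : X d) : chart n v 0 = (((n : ℤ) + 1) • v : X d) := by
  funext μ
  simp [chart, side]

/-- [folklore] block decay implies fine decay at rate `δ∕(n+1)`: `e^{−δ‖blk b − v‖∞} ≤ e^{δ}·e^{−(δ∕(n+1))·‖b − (n+1)•v‖∞}` (`δ ≥ 0`). -/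
theorem exp_blk_le_exp_fine (n : ℕ) {δ : ℝ} (hδ : 0 ≤ δ) (b v : X d) :
    Real.exp (-(δ * dist (blk n b) v))
      ≤ Real.exp δ * Real.exp (-(δ / ((n : ℝ) + 1)) * dist b (((n : ℤ) + 1) • v)) := by
  rw [← Real.exp_add]
  refine Real.exp_le_exp.2 ?_
  have hN : (0 : ℝ) < (n : ℝ) + 1 := by positivity
  have h := dist_le_blk_dist (mem_B.2 rfl : b ∈ B n (blk n b)) (chart_mem_B n v 0)
  rw [chart_zero_eq_smul] at h
  set F := dist b (((n : ℤ) + 1) • v) with hF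
  set D := dist (blk n b) v with hD
  have hD0 : 0 ≤ D := dist_nonneg
  -- `(δ/(n+1))·F ≤ (δ/(n+1))·((n+1)D + n) ≤ δD + δ`
  have h1 : δ / ((n : ℝ) + 1) * F ≤ δ / ((n : ℝ) + 1) * (((n : ℝ) + 1) * D + n) :=
    mul_le_mul_of_nonneg_left h (div_nonneg hδ hN.le)
  have h2 : δ / ((n : ℝ) + 1) * (((n : ℝ) + 1) * D + n) = δ * D + δ * (n / ((n : ℝ) + 1)) := by
    field_simp
  have h3 : δ * ((n : ℝ) / ((n : ℝ) + 1)) ≤ δ := by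
    have : (n : ℝ) / ((n : ℝ) + 1) ≤ 1 := by rw [div_le_one hN]; linarith
    nlinarith
  rw [neg_mul]
  linarith

/-! ## §2–§3 The letters in the road's spelling -/

open Beta.DyadicShell (Pt supNorm)
open CoarseInverseScalar (dist_eq_supNorm)

/-- **BLOCK FORM ⟹ ROAD FORM, (I)∕(J) + unit difference** (`d = 4`, any rate `δ > 0`, any constant `C ≥ 0`): block-distance letters
`|kerH n a x y| ≤ C·e^{−δ‖blk x − y‖∞}`, `|kerH n a (x+e_j) y − kerH n a x y| ≤ (C∕(n+1))·e^{−δ‖blk x − y‖∞}` (all `n x y`) give, for every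
blocking `N ≥ 1` (`n = N − 1`), `|kerH (N−1) a c u| ≤ C·e^{δ}·e^{−(δ∕N)·‖c − N•u‖∞}` and the unit difference with `C·e^{δ}∕N` — the `hI`∕`hJ` shape of
`MixLoopPowerCountingMass.coarse_mix2_secondMoment_le`. [folklore] -/
theorem letters_Pt_of_blk {a δ C : ℝ} (hδ : 0 ≤ δ) (hC : 0 ≤ C)
    (h : ∀ (n : ℕ) (x y : Pt), |kerH n a x y| ≤ C * Real.exp (-(δ * dist (blk n x) y)) ∧
      ∀ j : Fin 4, |kerH n a (x + e j) y - kerH n a x y| ≤ C / ((n : ℝ) + 1) * Real.exp (-(δ * dist (blk n x) y)))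
    (N : ℕ) (hN : 1 ≤ N) (c u : Pt) :
    |kerH (N - 1) a c u| ≤ C * Real.exp δ * Real.exp (-(δ / N) * (supNorm (c - (N : ℤ) • u) : ℝ)) ∧
      ∀ j : Fin 4, |kerH (N - 1) a (c + e j) u - kerH (N - 1) a c u|
        ≤ C * Real.exp δ / N * Real.exp (-(δ / N) * (supNorm (c - (N : ℤ) • u) : ℝ)) := by
  obtain ⟨n, rfl⟩ : ∃ n, N = n + 1 := ⟨N - 1, (Nat.sub_add_cancel hN).symm⟩
  rw [Nat.add_sub_cancel]
  obtain ⟨h1, h2⟩ := h n c u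
  have hex := exp_blk_le_exp_fine n hδ c u
  rw [dist_eq_supNorm c (((n : ℤ) + 1) • u)] at hex
  have hcast1 : (((n + 1 : ℕ) : ℤ)) = (n : ℤ) + 1 := by push_cast; ring
  have hcast2 : (((n + 1 : ℕ) : ℝ)) = (n : ℝ) + 1 := by push_cast; ring
  rw [hcast1, hcast2]
  refine ⟨h1.trans ?_, fun j => (h2 j).trans ?_⟩
  · calc C * Real.exp (-(δ * dist (blk n c) u))
        ≤ C * (Real.exp δ * Real.exp (-(δ / ((n : ℝ) + 1)) * (supNorm (c - ((n : ℤ) + 1) • u) : ℝ))) :=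
          mul_le_mul_of_nonneg_left hex hC
      _ = _ := by ring
  · have hCN : 0 ≤ C / ((n : ℝ) + 1) := by positivity
    calc C / ((n : ℝ) + 1) * Real.exp (-(δ * dist (blk n c) u))
        ≤ C / ((n : ℝ) + 1) * (Real.exp δ * Real.exp (-(δ / ((n : ℝ) + 1)) * (supNorm (c - ((n : ℤ) + 1) • u) : ℝ))) :=
          mul_le_mul_of_nonneg_left hex hCN
      _ = _ := by ring

/-- **BLOCK FORM ⟹ ROAD FORM, (J′)** (`d = 4`, any rate `δ > 0`, any `C ≥ 0`): the block-distance sup letter gives, for every `N ≥ 1`, every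
`b′` and every finite `V`, `Σ_{v∈V} (1 + (‖b′ − N•v‖∞∕N)²)·|kerH (N−1) a b′ v| ≤ 2·C·(16e^{δ∕2}∕δ²)·K₄(δ∕2)` — the `hJ'` shape of
`coarse_mix2_secondMoment_le` (a square against an exponential costs no power of `N`; coarse sum `B4Sect5Proof.latticeSum_le`). [folklore] -/
theorem coarseMoment_Pt_of_blk {a δ C : ℝ} (hδ : 0 < δ) (hC : 0 ≤ C)
    (h : ∀ (n : ℕ) (x y : Pt), |kerH n a x y| ≤ C * Real.exp (-(δ * dist (blk n x) y)))
    (N : ℕ) (hN : 1 ≤ N) (b' : Pt) (V : Finset Pt) :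
    ∑ v ∈ V, (1 + ((supNorm (b' - (N : ℤ) • v) : ℝ) / N) ^ 2) * |kerH (N - 1) a b' v|
      ≤ 2 * C * (16 * Real.exp (δ / 2) / δ ^ 2) * B4Sect5Proof.latticeConst 4 (δ / 2) := by
  have hδ2 : 0 < δ / 2 := half_pos hδ
  set K : ℝ := B4Sect5Proof.latticeConst 4 (δ / 2) with hK
  obtain ⟨n, rfl⟩ : ∃ n, N = n + 1 := ⟨N - 1, (Nat.sub_add_cancel hN).symm⟩
  rw [Nat.add_sub_cancel]
  have hcast1 : (((n + 1 : ℕ) : ℤ)) = (n : ℤ) + 1 := by push_cast; ring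
  have hcast2 : (((n + 1 : ℕ) : ℝ)) = (n : ℝ) + 1 := by push_cast; ring
  rw [hcast1, hcast2]
  have hNpos : (0 : ℝ) < (n : ℝ) + 1 := by positivity
  -- termwise: `(1 + (F/N)²)·|𝓘| ≤ 2C·(16e^{δ/2}/δ²)·e^{−(δ/2)·D_v}`, `D_v = ‖blk b′ − v‖∞`
  have hterm : ∀ v : Pt, (1 + ((supNorm (b' - ((n : ℤ) + 1) • v) : ℝ) / ((n : ℝ) + 1)) ^ 2) * |kerH n a b' v|
      ≤ 2 * C * (16 * Real.exp (δ / 2) / δ ^ 2) * Real.exp (-(δ / 2 * dist (blk n b') v)) := by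
    intro v
    set D := dist (blk n b') v with hD
    have hD0 : 0 ≤ D := dist_nonneg
    have hF : (supNorm (b' - ((n : ℤ) + 1) • v) : ℝ) ≤ ((n : ℝ) + 1) * D + n := by
      rw [← dist_eq_supNorm, ← chart_zero_eq_smul]
      exact dist_le_blk_dist (mem_B.2 rfl) (chart_mem_B n v 0)
    have hFN : (supNorm (b' - ((n : ℤ) + 1) • v) : ℝ) / ((n : ℝ) + 1) ≤ D + 1 := by
      rw [div_le_iff₀ hNpos]; nlinarith
    have hF0 : 0 ≤ (supNorm (b' - ((n : ℤ) + 1) • v) : ℝ) / ((n : ℝ) + 1) := by positivity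
    have hsq : (1 + ((supNorm (b' - ((n : ℤ) + 1) • v) : ℝ) / ((n : ℝ) + 1)) ^ 2) ≤ 2 * (D + 1) ^ 2 := by
      have := pow_le_pow_left₀ hF0 hFN 2
      nlinarith
    -- `(D+1)²·e^{−(δ/2)(D+1)} ≤ 4/(δ/2)² = 16/δ²`
    have hpoly : (D + 1) ^ 2 * Real.exp (-(δ / 2 * (D + 1))) ≤ 16 / δ ^ 2 := by
      have hx : 0 ≤ δ / 2 * (D + 1) / 2 := by positivity
      have h1 : δ / 2 * (D + 1) / 2 ≤ Real.exp (δ / 2 * (D + 1) / 2) := by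
        linarith [Real.add_one_le_exp (δ / 2 * (D + 1) / 2)]
      have h2 : (δ / 2 * (D + 1) / 2) ^ 2 ≤ Real.exp (δ / 2 * (D + 1) / 2) ^ 2 := pow_le_pow_left₀ hx h1 2
      rw [← Real.exp_nat_mul] at h2
      have h3 : ((2 : ℕ) : ℝ) * (δ / 2 * (D + 1) / 2) = δ / 2 * (D + 1) := by push_cast; ring
      rw [h3] at h2
      have hE : 0 < Real.exp (δ / 2 * (D + 1)) := Real.exp_pos _
      rw [Real.exp_neg, ← div_eq_mul_inv, div_le_div_iff₀ hE (by positivity)]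
      have : (δ / 2 * (D + 1) / 2) ^ 2 = δ ^ 2 * (D + 1) ^ 2 / 16 := by ring
      rw [this] at h2
      have h4 : δ ^ 2 * (D + 1) ^ 2 ≤ 16 * Real.exp (δ / 2 * (D + 1)) := by
        rw [div_le_iff₀ (by norm_num : (0:ℝ) < 16)] at h2; linarith
      nlinarith
    have hk := h n b' v
    have hsplit : Real.exp (-(δ * D)) = Real.exp (δ / 2) * Real.exp (-(δ / 2 * (D + 1))) * Real.exp (-(δ / 2 * D)) := by
      rw [← Real.exp_add, ← Real.exp_add]; congr 1; ring
    have hkabs : 0 ≤ |kerH n a b' v| := abs_nonneg _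
    calc (1 + ((supNorm (b' - ((n : ℤ) + 1) • v) : ℝ) / ((n : ℝ) + 1)) ^ 2) * |kerH n a b' v|
        ≤ (2 * (D + 1) ^ 2) * (C * Real.exp (-(δ * D))) :=
          mul_le_mul hsq hk hkabs (by positivity)
      _ = 2 * C * Real.exp (δ / 2) * ((D + 1) ^ 2 * Real.exp (-(δ / 2 * (D + 1)))) * Real.exp (-(δ / 2 * D)) := by
          rw [hsplit]; ring
      _ ≤ 2 * C * Real.exp (δ / 2) * (16 / δ ^ 2) * Real.exp (-(δ / 2 * D)) := by
          have h0 : 0 ≤ 2 * C * Real.exp (δ / 2) := by positivity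
          have hE : 0 ≤ Real.exp (-(δ / 2 * D)) := (Real.exp_pos _).le
          exact mul_le_mul_of_nonneg_right (mul_le_mul_of_nonneg_left hpoly h0) hE
      _ = 2 * C * (16 * Real.exp (δ / 2) / δ ^ 2) * Real.exp (-(δ / 2 * dist (blk n b') v)) := by rw [hD]; ring
  have h2C : 0 ≤ 2 * C * (16 * Real.exp (δ / 2) / δ ^ 2) := by positivity
  calc ∑ v ∈ V, (1 + ((supNorm (b' - ((n : ℤ) + 1) • v) : ℝ) / ((n : ℝ) + 1)) ^ 2) * |kerH n a b' v|
      ≤ ∑ v ∈ V, 2 * C * (16 * Real.exp (δ / 2) / δ ^ 2) * Real.exp (-(δ / 2 * dist (blk n b') v)) :=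
        Finset.sum_le_sum fun v _ => hterm v
    _ = 2 * C * (16 * Real.exp (δ / 2) / δ ^ 2) * ∑ v ∈ V, Real.exp (-(δ / 2 * dist (blk n b') v)) := by
        rw [Finset.mul_sum]
    _ ≤ 2 * C * (16 * Real.exp (δ / 2) / δ ^ 2) * K :=
        mul_le_mul_of_nonneg_left (B4Sect5Proof.latticeSum_le 4 hδ2 V (blk n b')) h2C

/-- **THE (I)∕(J) LETTER OF `MixLoopPowerCountingMass` FOR THE SCALAR MINIMISER, `C_I` FREE OF `N` AND OF `a`** (`d = 4`, blocking `N ≥ 1`,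
the minimiser `𝓘_gh(c,u) := kerH (N−1) a c u`, any `a > 0`): `∃ C_I ≥ 0, ∀ a > 0, ∀ N ≥ 1, ∀ c u, |𝓘_gh(c,u)| ≤ C_I·e^{−(δ∕N)·‖c − N•u‖∞}` —
verbatim the shape of the hypothesis `hI`∕`hJ` of `MixLoopPowerCountingMass.coarse_mix2_secondMoment_le` (`δ := deltaH 4 1`) — together with the
unit-difference companion `|𝓘_gh(c + e_j, u) − 𝓘_gh(c,u)| ≤ (C_I∕N)·e^{−(δ∕N)·‖c − N•u‖∞}` (one power of `N` better). [folklore] -/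
theorem exists_kerH_letters_Pt :
    ∃ C : ℝ, 0 ≤ C ∧ ∀ {a : ℝ}, 0 < a → ∀ (N : ℕ), 1 ≤ N → ∀ (c u : Pt),
      |kerH (N - 1) a c u| ≤ C * Real.exp (-(deltaH 4 1 / N) * (supNorm (c - (N : ℤ) • u) : ℝ)) ∧
      ∀ j : Fin 4, |kerH (N - 1) a (c + e j) u - kerH (N - 1) a c u|
        ≤ C / N * Real.exp (-(deltaH 4 1 / N) * (supNorm (c - (N : ℤ) • u) : ℝ)) := by
  obtain ⟨C, hC, h⟩ := exists_kerH_letters_afree (d := 4) (by norm_num)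
  exact ⟨C * Real.exp (deltaH 4 1), by positivity, fun {a} ha N hN c u =>
    letters_Pt_of_blk (deltaH_pos 4 one_pos).le hC (fun n x y => h ha n x y) N hN c u⟩

/-- The same at the `a`-DEPENDENT rate `δ_H(4,a)` with the displayed constant `C₀(4)·K(4,a)·e^{δ_H(4,a)}` of
`ScalarMinimiserLetters.exists_kerH_letters` (for consumers who carry `deltaH 4 a`). [folklore] -/
theorem exists_kerH_letters_Pt_rate :
    ∃ C₀ : ℝ, 0 ≤ C₀ ∧ ∀ {a : ℝ}, 0 < a → ∀ (N : ℕ), 1 ≤ N → ∀ (c u : Pt),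
      |kerH (N - 1) a c u| ≤ C₀ * ((cInv 4 a + a) * Real.exp (3 * deltaInv 4 a) + 7 ^ 4 * cH 4 a * Real.exp (3 * deltaH 4 a))
          * Real.exp (deltaH 4 a) * Real.exp (-(deltaH 4 a / N) * (supNorm (c - (N : ℤ) • u) : ℝ)) ∧
      ∀ j : Fin 4, |kerH (N - 1) a (c + e j) u - kerH (N - 1) a c u|
        ≤ C₀ * ((cInv 4 a + a) * Real.exp (3 * deltaInv 4 a) + 7 ^ 4 * cH 4 a * Real.exp (3 * deltaH 4 a))
          * Real.exp (deltaH 4 a) / N * Real.exp (-(deltaH 4 a / N) * (supNorm (c - (N : ℤ) • u) : ℝ)) := by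
  obtain ⟨C₀, hC₀, h⟩ := exists_kerH_letters (d := 4) (by norm_num)
  refine ⟨C₀, hC₀, fun {a} ha N hN c u => ?_⟩
  have hK : 0 ≤ C₀ * ((cInv 4 a + a) * Real.exp (3 * deltaInv 4 a) + 7 ^ 4 * cH 4 a * Real.exp (3 * deltaH 4 a)) := by
    have := (cInv_pos 4 ha).le; have := (cH_pos 4 ha).le; positivity
  exact letters_Pt_of_blk (deltaH_pos 4 ha).le hK (fun n x y => h ha n x y) N hN c u

/-- **THE (J′) COARSE-MOMENT LETTER FOR THE SCALAR MINIMISER, FREE OF `N` AND OF `a`** (`d = 4`, blocking `N ≥ 1`): `∃ C_J′ ≥ 0, ∀ a > 0,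
∀ N ≥ 1, ∀ b′, ∀ V` finite, `Σ_{v∈V} (1 + (‖b′ − N•v‖∞∕N)²)·|𝓘_gh(b′,v)| ≤ C_J′` — verbatim the shape of the hypothesis `hJ'` of
`MixLoopPowerCountingMass.coarse_mix2_secondMoment_le` (a square against an exponential costs no power of `N`; the coarse exponential sum is
`B4Sect5Proof.latticeSum_le`). [folklore] -/
theorem exists_kerH_coarseMoment_Pt :
    ∃ C' : ℝ, 0 ≤ C' ∧ ∀ {a : ℝ}, 0 < a → ∀ (N : ℕ), 1 ≤ N → ∀ (b' : Pt) (V : Finset Pt),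
      ∑ v ∈ V, (1 + ((supNorm (b' - (N : ℤ) • v) : ℝ) / N) ^ 2) * |kerH (N - 1) a b' v| ≤ C' := by
  obtain ⟨C, hC, h⟩ := exists_kerH_letters_afree (d := 4) (by norm_num)
  have hδ : 0 < deltaH 4 1 := deltaH_pos 4 one_pos
  have hK0 : 0 ≤ B4Sect5Proof.latticeConst 4 (deltaH 4 1 / 2) := B4Sect5Proof.latticeConst_nonneg 4 (half_pos hδ).le
  exact ⟨2 * C * (16 * Real.exp (deltaH 4 1 / 2) / deltaH 4 1 ^ 2) * B4Sect5Proof.latticeConst 4 (deltaH 4 1 / 2), by positivity,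
    fun {a} ha N hN b' V => coarseMoment_Pt_of_blk hδ hC (fun n x y => (h ha n x y).1) N hN b' V⟩

end Summit.QuantumFields.BalabanUV.Beta.FP.ScalarMinimiserLettersPt

end
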